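import Literature.NumberTheory.GaloisRepresentations.IdeleClassBarSLayerInvariants
import Literature.NumberTheory.GaloisRepresentations.IdeleClassModUnitsSQuotient
import Literature.NumberTheory.GaloisRepresentations.GalLayerSystemIdele
import Literature.Algebra.Homology.DiscreteRepLayerTransition
import Mathlib.RepresentationTheory.Homological.GroupCohomology.Functoriality
import HarnessLib

/-!
# The LAYERS of `C̄_S ∈ C_{G_S}`: the open normal subgroups `V̄_E = Gal(K_S/E) ≤ G_S` (`E ⊆ K_S`) are cofinal,
# `G_S ⧸ V̄_E ≃* Gal(E/K)`, `C̄_S^{V̄_E} ≃ C_S(E) = C_E ⧸ U_{E,S}` equivariantly, and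
# `Hⁿ(G_S ⧸ V̄_E, C̄_S^{V̄_E}) ≅ Hⁿ(Gal(E/K), C_S(E))` (NSW (8.3.7)–(8.3.9); Harari §17.4 (17.1); Serre I §2.2 Prop. 8)

Topic `NumberTheory/GaloisRepresentations`; namespace `Literature.NumberTheory.GaloisRepresentations.IdeleClassBar`.  Sequel to
`IdeleClassBarS.lean` (`classBarSD K S = C̄_S`, `ofLayerS`), `IdeleClassBarSLayerKernel.lean` (`ofLayerS_eq_zero_iff`),
`IdeleClassBarSLayerInvariants.lean` (`exists_ofLayerS_eq_of_forall_mem`), `IdeleClassModUnitsSQuotient.lean` (`classModUnitsπ :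
C_E ↠ C_S(E)` with kernel `im U_{E,S}`), door-c5's `IdeleClassGroupLimitLayers.lean` (`GalLayer.quotEquiv : Γ_K ⧸ U_E ≃* Gal(E/K)`)
and door-c4's `DiscreteRepInflation.lean` / `DiscreteRepLayerTransition.lean` (`invariantsQuotFunctor`, `invariantsStepIncl`).
Definitions with bodies (the layer subgroups, the group isomorphism, the layer module equivalence and the induced
isomorphism on group cohomology — PLUMBING, no new arithmetic object) and theorems; NO named fact, no instance, no
notation, no `sorry`.  Cell `bsd-eis`, background lane «PT-Ш-S-TC», brick D1-(ii) part 5b (the `W`-free top level asked for by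
the D2-CF consumer, bsd-line-x1-p1-w7 07:56:44Z (b)); written `--supports` crux `GoodLatticeBDPValue` (stmt-BirchSwinnertonDyer-19032).
HONEST FRAMING: layer bookkeeping for door-c4's layer colimit `Extⁿ_{C_{G_S}}(ℤ, C̄_S) = lim→_V Hⁿ(G_S ⧸ V, C̄_S^V)` (the descent of
the invariant map `inv_S`); no duality theorem and no case of BSD is proved here.

SETTING.  `K` a number field, `S : Finset` of finite places, `N_S = ramificationSubgroup K ↑S`, `G_S = Γ_K ⧸ N_S`
(`GaloisGroupUnramifiedOutside K ↑S`); a layer `E : GalLayer K` lies inside `K_S` when `hE : N_S ≤ galFixing K E.1`.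
* §1 **`layerSubgroupS S E : OpenNormalSubgroup G_S`** `= V̄_E := U_E N_S ⧸ N_S = Gal(K_S/E)` (image of `Gal(K̄/E)`; open by
  `isOpen_map_galFixing`, normal as the image of a normal subgroup under a surjection); antitone in `E`; **COFINAL** among
  the open normal subgroups of `G_S` (`exists_layerSubgroupS_le`: `V ⊇ V̄_E` for `E := K̄^{V N_S}`).
* §2 **`quotLayerSEquiv S hE : G_S ⧸ V̄_E ≃* Gal(E/K)`** (third isomorphism theorem + door-c5's `quotEquiv`), `[[σ]] ↦ σ|_E`.
* §3 the layer object **`layerRepS S E := C̄_S^{V̄_E}`** (door-c4's `invariantsQuotFunctor`, verbatim, so that `stepG`,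
  `inflG`, `LayerColimit.desc` apply), `toLayerS : C_E →+ C̄_S^{V̄_E}` — kernel `im U_{E,S}`, ONTO, equivariant.
* §4 **`layerSModuleEquiv S hE : (C̄_S^{V̄_E}).V ≃ₗ[ℤ] (C_S(E)).V`** with `C_S(E) = IdeleCohomology.classModUnitsRep K E.1 S`
  (both are `C_E ⧸ im U_{E,S}`), `layerSModuleEquiv [x] = π x`, EQUIVARIANT along `quotLayerSEquiv` (`layerSModuleEquiv_comm`).
* §5 **`layerSCohomologyIso S hE n : Hⁿ(G_S ⧸ V̄_E, C̄_S^{V̄_E}) ≅ Hⁿ(Gal(E/K), C_S(E))`** (Mathlib `groupCohomology.mapIso`).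
* §6 transitions: for `E ≤ E'` inside `K_S`, door-c4's inclusion `invariantsStepIncl : C̄_S^{V̄_E} ⊆ C̄_S^{V̄_{E'}}` is, under the
  `layerSModuleEquiv`s, Harari's transition `C_S(E) → C_S(E')` (`[x] ↦ π' (x_{E'})`; bsd-line-x1-p1-w4's `classModUnitsInflHom`).

## References
* J. Neukirch, A. Schmidt, K. Wingberg, *Cohomology of Number Fields*, 2nd ed. (2008), VIII §3 (8.3.7)–(8.3.9). [NeukirchSchmidtWingberg2008]
* D. Harari, *Galois Cohomology and Class Field Theory*, Universitext (2020), Def. 15.38, §17.1 Thm. 17.2, §17.4 (17.1). [Harari2020]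
* J.-P. Serre, *Galois Cohomology*, Springer (1997), I §2.2 Proposition 8. [SerreGaloisCohomology1997]
-/

noncomputable section

open NumberField IsDedekindDomain CategoryTheory CategoryTheory.Limits groupCohomology
open Field (absoluteGaloisGroup)
open Literature.NumberTheory.Automorphic Literature.NumberTheory.Automorphic.IdeleClassGroup
open Literature.NumberTheory.NumberFields
open Literature.Algebra.Homology
open Literature.NumberTheory.GaloisRepresentations.LocalWeilDatum (galFixing mem_galFixing_iff galFixing_antitone)
open scoped Classical

namespace Literature.NumberTheory.GaloisRepresentations

namespace IdeleClassBar

variable {K : Type} [Field K] [NumberField K] (S : Finset (HeightOneSpectrum (𝓞 K)))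

/-! ## §1. The layer subgroups `V̄_E = Gal(K_S/E) ≤ G_S` and their cofinality -/

/-- **`V̄_E = Gal(K_S/E)`, the image of `Gal(K̄/E)` in `G_S = Γ_K ⧸ N_S`, as an open normal subgroup of `G_S`** (open:
`Γ_K → G_S` is an open map; normal: the image of a normal subgroup under a surjection).  For `E ⊆ K_S` it is `U_E N_S ⧸ N_S =
U_E ⧸ N_S`. [cite: NeukirchSchmidtWingberg2008, VIII §3][cite: SerreGaloisCohomology1997, I §2.2 Proposition 8] -/
def layerSubgroupS (E : GalLayer K) : OpenNormalSubgroup (GaloisGroupUnramifiedOutside K (↑S : Set (HeightOneSpectrum (𝓞 K)))) where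
  toSubgroup := (galFixing K E.1).map (QuotientGroup.mk' (ramificationSubgroup K (↑S : Set (HeightOneSpectrum (𝓞 K)))))
  isOpen' := isOpen_map_galFixing S E
  isNormal' := by
    haveI : (galFixing K E.1).Normal := GalLayer.fixingSubgroup_normal E
    exact Subgroup.Normal.map this
      (QuotientGroup.mk' (ramificationSubgroup K (↑S : Set (HeightOneSpectrum (𝓞 K)))))
      (QuotientGroup.mk'_surjective (ramificationSubgroup K (↑S : Set (HeightOneSpectrum (𝓞 K)))))

omit [NumberField K] in
/-- `V̄_E` as a subgroup is the image of `Gal(K̄/E)`. [cite: NeukirchSchmidtWingberg2008, VIII §3] -/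
theorem coe_layerSubgroupS (E : GalLayer K) :
    (layerSubgroupS S E : Subgroup (GaloisGroupUnramifiedOutside K (↑S : Set (HeightOneSpectrum (𝓞 K))))) =
      (galFixing K E.1).map (QuotientGroup.mk' (ramificationSubgroup K (↑S : Set (HeightOneSpectrum (𝓞 K))))) := rfl

omit [NumberField K] in
/-- Membership in `V̄_E`: the class of some `σ ∈ Gal(K̄/E)`. [cite: NeukirchSchmidtWingberg2008, VIII §3] -/
theorem mem_layerSubgroupS_iff (E : GalLayer K) (g : GaloisGroupUnramifiedOutside K (↑S : Set (HeightOneSpectrum (𝓞 K)))) :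
    g ∈ layerSubgroupS S E ↔ ∃ σ ∈ galFixing K E.1, (QuotientGroup.mk σ : GaloisGroupUnramifiedOutside K _) = g :=
  Subgroup.mem_map

omit [NumberField K] in
/-- `[σ] ∈ V̄_E` for `σ ∈ Gal(K̄/E)`. [cite: NeukirchSchmidtWingberg2008, VIII §3] -/
theorem mk_mem_layerSubgroupS (E : GalLayer K) {σ : absoluteGaloisGroup K} (hσ : σ ∈ galFixing K E.1) :
    (QuotientGroup.mk σ : GaloisGroupUnramifiedOutside K (↑S : Set (HeightOneSpectrum (𝓞 K)))) ∈ layerSubgroupS S E :=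
  (mem_layerSubgroupS_iff S E _).2 ⟨σ, hσ, rfl⟩

omit [NumberField K] in
/-- **`E ≤ E' ⟹ V̄_{E'} ≤ V̄_E`.** [cite: SerreGaloisCohomology1997, I §2.2 Proposition 8] -/
theorem layerSubgroupS_anti {E E' : GalLayer K} (h : E ≤ E') :
    (layerSubgroupS S E' : Subgroup (GaloisGroupUnramifiedOutside K (↑S : Set (HeightOneSpectrum (𝓞 K))))) ≤ layerSubgroupS S E :=
  Subgroup.map_mono (galFixing_antitone K h)

/-- **The layer subgroups are COFINAL**: every open normal `V ≤ G_S` contains `V̄_E` for some layer `E ⊆ K_S` (take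
`E := K̄^{W}` for the open normal `W := V N_S ≤ Γ_K`, the preimage of `V`; then `V̄_E = V`).
[cite: SerreGaloisCohomology1997, I §2.2 Proposition 8][cite: NeukirchSchmidtWingberg2008, VIII §3] -/
theorem exists_layerSubgroupS_le (V : OpenNormalSubgroup (GaloisGroupUnramifiedOutside K (↑S : Set (HeightOneSpectrum (𝓞 K))))) :
    ∃ (E : GalLayer K), ramificationSubgroup K (↑S : Set (HeightOneSpectrum (𝓞 K))) ≤ galFixing K E.1 ∧
      (layerSubgroupS S E : Subgroup (GaloisGroupUnramifiedOutside K (↑S : Set (HeightOneSpectrum (𝓞 K))))) ≤ V := by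
  -- the preimage `W` of `V` in `Γ_K`: open, normal, contains `N_S`
  let W : OpenNormalSubgroup (absoluteGaloisGroup K) :=
    { toSubgroup := (V : Subgroup (GaloisGroupUnramifiedOutside K (↑S : Set (HeightOneSpectrum (𝓞 K))))).comap
          (QuotientGroup.mk' (ramificationSubgroup K (↑S : Set (HeightOneSpectrum (𝓞 K)))))
      isOpen' := V.toOpenSubgroup.isOpen.preimage (continuous_toUnramifiedQuot K _)
      isNormal' := Subgroup.Normal.comap inferInstance _ }
  have hW : (W : Subgroup (absoluteGaloisGroup K)) =
      (V : Subgroup (GaloisGroupUnramifiedOutside K (↑S : Set (HeightOneSpectrum (𝓞 K))))).comap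
        (QuotientGroup.mk' (ramificationSubgroup K (↑S : Set (HeightOneSpectrum (𝓞 K))))) := rfl
  refine ⟨GalLayer.ofOpenNormalSubgroup W, ?_, ?_⟩
  · rw [galFixing_eq_coe_openNormalSubgroup, GalLayer.openNormalSubgroup_ofOpenNormalSubgroup, hW]
    intro σ hσ
    rw [Subgroup.mem_comap, QuotientGroup.mk'_apply, (QuotientGroup.eq_one_iff σ).2 hσ]
    exact one_mem _
  · rw [coe_layerSubgroupS, galFixing_eq_coe_openNormalSubgroup, GalLayer.openNormalSubgroup_ofOpenNormalSubgroup, hW,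
      Subgroup.map_comap_eq_self_of_surjective (QuotientGroup.mk'_surjective _)]

/-! ## §2. `G_S ⧸ V̄_E ≃* Gal(E/K)` -/

/-- **`G_S ⧸ V̄_E ≃* Gal(E/K)`** for `E ⊆ K_S`: `(Γ_K ⧸ N_S) ⧸ (U_E N_S ⧸ N_S) ≃* Γ_K ⧸ U_E` (third isomorphism theorem,
`N_S ≤ U_E`) followed by door-c5's `Γ_K ⧸ U_E ≃* Gal(E/K)`, `[σ] ↦ σ|_E`.
[cite: SerreGaloisCohomology1997, I §2.2 Proposition 8][cite: NeukirchSchmidtWingberg2008, VIII §3] -/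
def quotLayerSEquiv {E : GalLayer K} (hE : ramificationSubgroup K (↑S : Set (HeightOneSpectrum (𝓞 K))) ≤ galFixing K E.1) :
    GaloisGroupUnramifiedOutside K (↑S : Set (HeightOneSpectrum (𝓞 K))) ⧸
        (layerSubgroupS S E : Subgroup (GaloisGroupUnramifiedOutside K (↑S : Set (HeightOneSpectrum (𝓞 K))))) ≃*
      (E.1 ≃ₐ[K] E.1) :=
  haveI : (galFixing K E.1).Normal := GalLayer.fixingSubgroup_normal E
  (QuotientGroup.quotientQuotientEquivQuotient (ramificationSubgroup K (↑S : Set (HeightOneSpectrum (𝓞 K))))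
      (galFixing K E.1) hE).trans E.quotEquiv

/-- Formula: `quotLayerSEquiv [[σ]] = σ|_E`. [cite: SerreGaloisCohomology1997, I §2.2 Proposition 8] -/
theorem quotLayerSEquiv_mk_mk {E : GalLayer K}
    (hE : ramificationSubgroup K (↑S : Set (HeightOneSpectrum (𝓞 K))) ≤ galFixing K E.1) (σ : absoluteGaloisGroup K) :
    quotLayerSEquiv S hE (QuotientGroup.mk (QuotientGroup.mk σ)) = GalLayer.restrictHom E σ := by
  haveI : (galFixing K E.1).Normal := GalLayer.fixingSubgroup_normal E
  change E.quotEquiv (QuotientGroup.quotientQuotientEquivQuotient _ (galFixing K E.1) hE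
    (QuotientGroup.mk (QuotientGroup.mk σ))) = _
  have h1 : QuotientGroup.quotientQuotientEquivQuotient (ramificationSubgroup K (↑S : Set (HeightOneSpectrum (𝓞 K))))
      (galFixing K E.1) hE (QuotientGroup.mk (QuotientGroup.mk σ)) = QuotientGroup.mk σ :=
    QuotientGroup.quotientQuotientEquivQuotientAux_mk_mk _ _ hE σ
  rw [h1]
  rfl

/-! ## §3. The layer objects `C̄_S^{V̄_E}` and the map `C_E → C̄_S^{V̄_E}` -/

/-- **The layer object `C̄_S^{V̄_E}` of door-c4's system** for `C̄_S ∈ C_{G_S}` at the open normal subgroup `V̄_E`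
(`invariantsQuotFunctor`; an abbreviation). [cite: SerreGaloisCohomology1997, I §2.2 Proposition 8] -/
abbrev layerRepS (E : GalLayer K) :
    Rep ℤ (GaloisGroupUnramifiedOutside K (↑S : Set (HeightOneSpectrum (𝓞 K))) ⧸
      (layerSubgroupS S E : Subgroup (GaloisGroupUnramifiedOutside K (↑S : Set (HeightOneSpectrum (𝓞 K)))))) :=
  (DiscreteRep.invariantsQuotFunctor ℤ
    (layerSubgroupS S E : Subgroup (GaloisGroupUnramifiedOutside K (↑S : Set (HeightOneSpectrum (𝓞 K)))))).obj (classBarSD K S)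

/-- The underlying vector of `[g] • z` in `C̄_S^{V̄_E}` is `g • z` (unfolding). [cite: Harari2020, §4.3 Remark 4.24] -/
theorem coe_layerRepS_ρ_mk (E : GalLayer K) (g : GaloisGroupUnramifiedOutside K (↑S : Set (HeightOneSpectrum (𝓞 K))))
    (z : (layerRepS S E).V) :
    (((layerRepS S E).ρ (QuotientGroup.mk g) z).1 : (classBarSRep K S).V) = (classBarSRep K S).ρ g z.1 := rfl

section Layer

variable {E : GalLayer K} (hE : ramificationSubgroup K (↑S : Set (HeightOneSpectrum (𝓞 K))) ≤ galFixing K E.1)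

/-- The image of `C_E` in `C̄_S` is fixed by `V̄_E`. [cite: NeukirchSchmidtWingberg2008, VIII §3 (8.3.7)] -/
theorem ofLayerS_mem_invariants_layerSubgroupS (x : layerClass K E) :
    ofLayerS S hE x ∈ Representation.invariants ((classBarSRep K S).ρ.comp
      (layerSubgroupS S E : Subgroup (GaloisGroupUnramifiedOutside K (↑S : Set (HeightOneSpectrum (𝓞 K))))).subtype) := by
  intro v
  obtain ⟨σ, hσ, hv⟩ := (mem_layerSubgroupS_iff S E v.1).1 v.2
  change (classBarSRep K S).ρ v.1 (ofLayerS S hE x) = ofLayerS S hE x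
  rw [← hv]
  exact classBarSRep_ρ_mk_ofLayerS_of_mem S hE hσ x

/-- **`C_E → C̄_S^{V̄_E}`, `x ↦ [x]`.** [cite: NeukirchSchmidtWingberg2008, VIII §3 (8.3.7)] -/
def toLayerS : layerClass K E →+ (layerRepS S E).V :=
  AddMonoidHom.mk' (fun x => ⟨ofLayerS S hE x, ofLayerS_mem_invariants_layerSubgroupS S hE x⟩) fun x y =>
    Subtype.ext (map_add (ofLayerS S hE) x y)

/-- Formula: the underlying vector of `toLayerS x` is `ofLayerS x`. [cite: NeukirchSchmidtWingberg2008, VIII §3 (8.3.7)] -/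
@[simp] theorem coe_toLayerS (x : layerClass K E) : ((toLayerS S hE x).1 : (classBarSRep K S).V) = ofLayerS S hE x := rfl

/-- **The kernel of `C_E → C̄_S^{V̄_E}` is `im(U_{E,S} → C_E)`** (kernel file).
[cite: Harari2020, Def. 15.38, §17.1 Thm. 17.2 (proof)] -/
theorem toLayerS_eq_zero_iff (x : layerClass K E) :
    toLayerS S hE x = 0 ↔
      (haveI := E.numberField; x ∈ (IdeleCohomology.unitsOffToClass (F := K) (E := E.1) S).hom.range) := by
  rw [← ofLayerS_eq_zero_iff S hE x]
  exact ⟨fun h => congrArg Subtype.val h, fun h => Subtype.ext h⟩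

/-- `toLayerS x = toLayerS y ↔ x - y ∈ im U_{E,S}`. [cite: Harari2020, Def. 15.38] -/
theorem toLayerS_eq_iff (x y : layerClass K E) :
    toLayerS S hE x = toLayerS S hE y ↔
      (haveI := E.numberField; x - y ∈ (IdeleCohomology.unitsOffToClass (F := K) (E := E.1) S).hom.range) := by
  rw [← sub_eq_zero, ← map_sub, toLayerS_eq_zero_iff]

/-- **`C_E → C̄_S^{V̄_E}` is onto** (invariants file: a `V̄_E`-invariant is fixed by every `[σ]`, `σ ∈ Gal(K̄/E)`).
[cite: NeukirchSchmidtWingberg2008, VIII §3 (8.3.7)][cite: Harari2020, Prop. 15.40 (b)] -/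
theorem toLayerS_surjective : Function.Surjective (toLayerS S hE) := by
  intro z
  obtain ⟨x, hx⟩ := exists_ofLayerS_eq_of_forall_mem S hE z.1 fun σ hσ => z.2 ⟨_, mk_mem_layerSubgroupS S E hσ⟩
  exact ⟨x, Subtype.ext hx⟩

/-- **Equivariance**: `[[σ]] • [x] = [σ|_E • x]`. [cite: NeukirchSchmidtWingberg2008, VIII §3 (8.3.8)] -/
theorem layerRepS_ρ_mk_mk_toLayerS (σ : absoluteGaloisGroup K) (x : layerClass K E) :
    (layerRepS S E).ρ (QuotientGroup.mk (QuotientGroup.mk σ)) (toLayerS S hE x) = toLayerS S hE (layerAct K E σ x) :=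
  Subtype.ext (classBarSRep_ρ_mk_ofLayerS S σ hE x)

/-! ## §4. The layer module `C̄_S^{V̄_E} ≃ₗ[ℤ] C_S(E)` -/

/-- The kernels of `C_E → C̄_S^{V̄_E}` and of `π : C_E → C_S(E)` coincide (both are `im U_{E,S}`). [cite: Harari2020, Def. 15.38] -/
theorem ker_toLayerS_eq :
    (toLayerS S hE).ker = (haveI := E.numberField; (IdeleCohomology.classModUnitsπ (F := K) (E := E.1) S).ker) := by
  haveI := E.numberField
  ext x
  rw [AddMonoidHom.mem_ker, toLayerS_eq_zero_iff, IdeleCohomology.mem_ker_classModUnitsπ_iff]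

/-- The forward map `C̄_S^{V̄_E} →+ C_S(E)`, `[x] ↦ π x` (descent of `π` along the surjection `toLayerS`).
[cite: NeukirchSchmidtWingberg2008, VIII §3 (8.3.8)] -/
def layerSToClassModUnits : (layerRepS S E).V →+ (haveI := E.numberField; (IdeleCohomology.classModUnitsRep K E.1 S).V) :=
  haveI := E.numberField
  (toLayerS S hE).liftOfSurjective (toLayerS_surjective S hE)
    ⟨IdeleCohomology.classModUnitsπ (F := K) (E := E.1) S, (ker_toLayerS_eq S hE).le⟩

/-- Formula: `layerSToClassModUnits [x] = π x`. [cite: NeukirchSchmidtWingberg2008, VIII §3 (8.3.8)] -/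
theorem layerSToClassModUnits_toLayerS (x : layerClass K E) :
    layerSToClassModUnits S hE (toLayerS S hE x) =
      (haveI := E.numberField; (cokernel.π (IdeleCohomology.unitsOffToClass (F := K) (E := E.1) S)).hom x) :=
  AddMonoidHom.liftOfRightInverse_comp_apply (toLayerS S hE) _ _ _ x

/-- The backward map `C_S(E) →+ C̄_S^{V̄_E}`, `π x ↦ [x]` (descent of `toLayerS` along the surjection `π`).
[cite: NeukirchSchmidtWingberg2008, VIII §3 (8.3.8)] -/
def classModUnitsToLayerS : (haveI := E.numberField; (IdeleCohomology.classModUnitsRep K E.1 S).V) →+ (layerRepS S E).V :=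
  haveI := E.numberField
  (IdeleCohomology.classModUnitsπ (F := K) (E := E.1) S).liftOfSurjective
    (IdeleCohomology.classModUnitsπ_surjective S) ⟨toLayerS S hE, (ker_toLayerS_eq S hE).ge⟩

/-- Formula: `classModUnitsToLayerS (π x) = [x]`. [cite: NeukirchSchmidtWingberg2008, VIII §3 (8.3.8)] -/
theorem classModUnitsToLayerS_π (x : layerClass K E) :
    classModUnitsToLayerS S hE
        (haveI := E.numberField; (cokernel.π (IdeleCohomology.unitsOffToClass (F := K) (E := E.1) S)).hom x) =
      toLayerS S hE x :=
  haveI := E.numberField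
  AddMonoidHom.liftOfRightInverse_comp_apply (IdeleCohomology.classModUnitsπ (F := K) (E := E.1) S) _ _ _ x

/-- **`C̄_S^{V̄_E} ≃+ C_S(E)`**: the two descended maps are mutually inverse. [cite: NeukirchSchmidtWingberg2008, VIII §3 (8.3.8)] -/
def layerSAddEquiv : (layerRepS S E).V ≃+ (haveI := E.numberField; (IdeleCohomology.classModUnitsRep K E.1 S).V) :=
  { layerSToClassModUnits S hE with
    invFun := classModUnitsToLayerS S hE
    left_inv := fun z => by
      obtain ⟨x, rfl⟩ := toLayerS_surjective S hE z
      change classModUnitsToLayerS S hE (layerSToClassModUnits S hE (toLayerS S hE x)) = _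
      rw [layerSToClassModUnits_toLayerS, classModUnitsToLayerS_π]
    right_inv := fun c => by
      haveI := E.numberField
      obtain ⟨x, rfl⟩ := IdeleCohomology.classModUnitsπ_surjective S c
      change layerSToClassModUnits S hE (classModUnitsToLayerS S hE _) = _
      rw [IdeleCohomology.classModUnitsπ_apply, classModUnitsToLayerS_π, layerSToClassModUnits_toLayerS] }

/-- Formula: `layerSAddEquiv [x] = π x`. [cite: NeukirchSchmidtWingberg2008, VIII §3 (8.3.8)] -/
theorem layerSAddEquiv_toLayerS (x : layerClass K E) :
    layerSAddEquiv S hE (toLayerS S hE x) =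
      (haveI := E.numberField; (cokernel.π (IdeleCohomology.unitsOffToClass (F := K) (E := E.1) S)).hom x) :=
  layerSToClassModUnits_toLayerS S hE x

/-- **The layer module `C̄_S^{V̄_E} ≃ₗ[ℤ] C_S(E)`** for the `ℤ`-module structures CARRIED BY THE TWO `Rep` OBJECTS (so that
Mathlib's `groupCohomology.mapIso` applies verbatim; any additive equivalence is `ℤ`-linear, `Int.cast_smul_eq_zsmul`).
[cite: NeukirchSchmidtWingberg2008, VIII §3 (8.3.8)][cite: Harari2020, §17.1 Thm. 17.2 (proof)] -/
def layerSModuleEquiv :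
    letI := (layerRepS S E).hV2
    letI := (haveI := E.numberField; IdeleCohomology.classModUnitsRep K E.1 S).hV2
    (layerRepS S E).V ≃ₗ[ℤ] (haveI := E.numberField; (IdeleCohomology.classModUnitsRep K E.1 S).V) := by
  letI := (layerRepS S E).hV2
  letI := (haveI := E.numberField; IdeleCohomology.classModUnitsRep K E.1 S).hV2
  exact
    { layerSAddEquiv S hE with
      map_smul' := fun c z => by
        simp only [AddEquiv.toFun_eq_coe, RingHom.id_apply]
        exact (congrArg (layerSAddEquiv S hE) (Int.cast_smul_eq_zsmul ℤ c z)).trans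
          ((map_zsmul (layerSAddEquiv S hE) c z).trans (Int.cast_smul_eq_zsmul ℤ c (layerSAddEquiv S hE z)).symm) }

/-- Formula: `layerSModuleEquiv [x] = π x`. [cite: NeukirchSchmidtWingberg2008, VIII §3 (8.3.8)] -/
theorem layerSModuleEquiv_toLayerS (x : layerClass K E) :
    layerSModuleEquiv S hE (toLayerS S hE x) =
      (haveI := E.numberField; (cokernel.π (IdeleCohomology.unitsOffToClass (F := K) (E := E.1) S)).hom x) := by
  letI := (layerRepS S E).hV2
  letI := (haveI := E.numberField; IdeleCohomology.classModUnitsRep K E.1 S).hV2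
  exact layerSToClassModUnits_toLayerS S hE x

/-- Equivariance on generators: `layerSModuleEquiv ([[σ]] • [x]) = σ|_E • layerSModuleEquiv [x]` (`π` is `Gal(E/K)`-equivariant).
[cite: NeukirchSchmidtWingberg2008, VIII §3 (8.3.8)] -/
theorem layerSModuleEquiv_ρ_mk_mk (σ : absoluteGaloisGroup K) (x : layerClass K E) :
    layerSModuleEquiv S hE ((layerRepS S E).ρ (QuotientGroup.mk (QuotientGroup.mk σ)) (toLayerS S hE x)) =
      (haveI := E.numberField; (IdeleCohomology.classModUnitsRep K E.1 S).ρ (GalLayer.restrictHom E σ)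
        (layerSModuleEquiv S hE (toLayerS S hE x))) := by
  haveI := E.numberField
  simp only [layerRepS_ρ_mk_mk_toLayerS, layerSModuleEquiv_toLayerS]
  exact Rep.hom_comm_apply (cokernel.π (IdeleCohomology.unitsOffToClass (F := K) (E := E.1) S))
    (GalLayer.restrictHom E σ) x

/-- **Equivariance of `layerSModuleEquiv` along `quotLayerSEquiv : G_S ⧸ V̄_E ≃* Gal(E/K)`**:
`layerSModuleEquiv (g • z) = (quotLayerSEquiv g) • layerSModuleEquiv z` — the hypothesis of `groupCohomology.mapIso`.
[cite: NeukirchSchmidtWingberg2008, VIII §3 (8.3.8)][cite: SerreGaloisCohomology1997, I §2.2 Proposition 8] -/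
theorem layerSModuleEquiv_comm
    (g : GaloisGroupUnramifiedOutside K (↑S : Set (HeightOneSpectrum (𝓞 K))) ⧸
      (layerSubgroupS S E : Subgroup (GaloisGroupUnramifiedOutside K (↑S : Set (HeightOneSpectrum (𝓞 K)))))) :
    letI := (layerRepS S E).hV2; letI := (haveI := E.numberField; IdeleCohomology.classModUnitsRep K E.1 S).hV2;
    (layerSModuleEquiv S hE).toLinearMap ∘ₗ (layerRepS S E).ρ g =
      (haveI := E.numberField; (IdeleCohomology.classModUnitsRep K E.1 S).ρ (quotLayerSEquiv S hE g)) ∘ₗ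
        (layerSModuleEquiv S hE).toLinearMap := by
  haveI := E.numberField
  letI := (layerRepS S E).hV2
  letI := (IdeleCohomology.classModUnitsRep K E.1 S).hV2
  induction g using QuotientGroup.induction_on with
  | H u =>
    induction u using QuotientGroup.induction_on with
    | H σ =>
      refine LinearMap.ext fun z => ?_
      obtain ⟨x, rfl⟩ := toLayerS_surjective S hE z
      change layerSModuleEquiv S hE ((layerRepS S E).ρ (QuotientGroup.mk (QuotientGroup.mk σ)) (toLayerS S hE x)) =
        (IdeleCohomology.classModUnitsRep K E.1 S).ρ (quotLayerSEquiv S hE (QuotientGroup.mk (QuotientGroup.mk σ)))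
          (layerSModuleEquiv S hE (toLayerS S hE x))
      rw [quotLayerSEquiv_mk_mk]
      exact layerSModuleEquiv_ρ_mk_mk S hE σ x

/-! ## §5. `Hⁿ(G_S ⧸ V̄_E, C̄_S^{V̄_E}) ≅ Hⁿ(Gal(E/K), C_S(E))` -/

/-- **The layers of `C̄_S` have the cohomology of Harari's `C_S(E)`: `Hⁿ(G_S ⧸ V̄_E, C̄_S^{V̄_E}) ≅ Hⁿ(Gal(E/K), C_S(E))`**
(Mathlib `groupCohomology.mapIso` along `quotLayerSEquiv`, `layerSModuleEquiv`) — with `C_S(E) = IdeleCohomology.classModUnitsRep K E S`,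
the class module of bsd-line-x1-p1-w4's tower (`classModUnitsInf`).  NSW (8.3.9): `Hʳ(G_S, C_S) = lim→_E Hʳ(Gal(E/K), C_S(E))`.
[cite: NeukirchSchmidtWingberg2008, VIII §3 (8.3.9)][cite: SerreGaloisCohomology1997, I §2.2 Proposition 8] -/
def layerSCohomologyIso (n : ℕ) :
    groupCohomology (layerRepS S E) n ≅ groupCohomology (haveI := E.numberField; IdeleCohomology.classModUnitsRep K E.1 S) n :=
  haveI := E.numberField
  groupCohomology.mapIso (quotLayerSEquiv S hE) (layerSModuleEquiv S hE) (layerSModuleEquiv_comm S hE) n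

end Layer

/-! ## §6. Transitions: `invariantsStepIncl` is Harari's `C_S(E) → C_S(E')` -/

/-- **Under the `layerSModuleEquiv`s, door-c4's inclusion `C̄_S^{V̄_E} ⊆ C̄_S^{V̄_{E'}}` (`E ≤ E'` inside `K_S`) sends `[x]_E` to
`π' (x_{E'})`**, the class in `C_S(E')` of the base change of `x` (door-c5's transition `transHom`).
[cite: NeukirchSchmidtWingberg2008, VIII §3 (8.3.9)][cite: Harari2020, §17.4 (17.1)] -/
theorem layerSModuleEquiv_invariantsStepIncl {E E' : GalLayer K} (h : E ≤ E')
    (hE : ramificationSubgroup K (↑S : Set (HeightOneSpectrum (𝓞 K))) ≤ galFixing K E.1)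
    (hE' : ramificationSubgroup K (↑S : Set (HeightOneSpectrum (𝓞 K))) ≤ galFixing K E'.1) (x : layerClass K E) :
    layerSModuleEquiv S hE'
        ((DiscreteRep.invariantsStepIncl
          (layerSubgroupS S E : Subgroup (GaloisGroupUnramifiedOutside K (↑S : Set (HeightOneSpectrum (𝓞 K)))))
          (layerSubgroupS S E' : Subgroup (GaloisGroupUnramifiedOutside K (↑S : Set (HeightOneSpectrum (𝓞 K)))))
          (layerSubgroupS_anti S h) (classBarSD K S)).hom (toLayerS S hE x)) =
      (haveI := E'.numberField; (cokernel.π (IdeleCohomology.unitsOffToClass (F := K) (E := E'.1) S)).hom (transHom E E' h x)) := by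
  have h1 : (DiscreteRep.invariantsStepIncl
      (layerSubgroupS S E : Subgroup (GaloisGroupUnramifiedOutside K (↑S : Set (HeightOneSpectrum (𝓞 K)))))
      (layerSubgroupS S E' : Subgroup (GaloisGroupUnramifiedOutside K (↑S : Set (HeightOneSpectrum (𝓞 K)))))
      (layerSubgroupS_anti S h) (classBarSD K S)).hom (toLayerS S hE x) = toLayerS S hE' (transHom E E' h x) :=
    Subtype.ext (ofLayerS_transHom S h hE hE' x).symm
  rw [h1, layerSModuleEquiv_toLayerS]

/-- The same transition read in bsd-line-x1-p1-w4's currency: `π' (x_{E'}) = classModUnitsInflHom (π x)` (door-c5's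
`transHom` is the base change, `transHom_eq_baseChangeHom`; `classModUnitsInflHom_hom_apply_π`).
[cite: Harari2020, §17.4 (17.1)][cite: NeukirchSchmidtWingberg2008, VIII §3 (8.3.9)] -/
theorem π_transHom_eq_classModUnitsInflHom {E E' : GalLayer K} (h : E ≤ E') (x : layerClass K E) :
    (haveI := E'.numberField; (cokernel.π (IdeleCohomology.unitsOffToClass (F := K) (E := E'.1) S)).hom (transHom E E' h x)) =
      (haveI := E.numberField; haveI := E'.numberField; haveI := E.isGalois; letI := GalLayer.algebraOfLE h;
        haveI := GalLayer.isScalarTower_of_le h;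
        (IdeleCohomology.classModUnitsInflHom K E.1 E'.1 S).hom
          ((cokernel.π (IdeleCohomology.unitsOffToClass (F := K) (E := E.1) S)).hom x)) := by
  haveI := E.numberField
  haveI := E'.numberField
  haveI := E.isGalois
  letI := GalLayer.algebraOfLE h
  haveI := GalLayer.isScalarTower_of_le h
  rw [IdeleCohomology.classModUnitsInflHom_hom_apply_π, transHom_eq_baseChangeHom]
  rfl

end IdeleClassBar

end Literature.NumberTheory.GaloisRepresentations

end
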